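import Summits.QuantumFields.BalabanUV.Beta.SymSliceProjectorFixed

/-!
# `BalabanUV.Beta.SymGaugeMultiplierBlockMean` — binder row D1, JSB12SYM-SPINE v1.1 (Σ3) step K2 part b: `Π^{sym}_bm (dz f) = dz (blockMeanAt N f)`,
# THE ROWS OF `Π^{sym}_bm` HAVE BLOCK-CONSTANT CODIFFERENTIAL, and THEIR GAUGE MULTIPLIER VANISHES (pattern `GaugeMultiplierBlockMean` §2–3 verbatim
# for the symmetrised projector; the energy engine `McolSum_eq_zero_of_isBlockConst` BY NAME)

CHART (RULING R-D1-g25-4): chart (II) — fixed κ = 0 slice; hSX separate.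
HONEST FRAMING (cell contract, verbatim): «discharging `BetaPertH` makes Bałaban's UV stability UNCONDITIONAL — a real constructive-QFT
result; it is NOT the continuum limit and NOT the Clay problem.»  THIS MODULE DISCHARGES NOTHING of `BetaPertH` ∕ row D1: [folklore] bookkeeping of
OUR objects.  0 sorry, 0 `def … : Prop`, nothing cited.  NOT HERE (K2 parts c–e): `resid ∘ Π̂ᵀ_sym = Π̂ᵀ_sym,C`, blindness, the `RelInv` assembly.
NOT D1, NOT BetaPertH, NOT continuum, NOT Clay.
HONEST DEPENDENCY (verbatim): «continuum YM on T⁴ ⇐ BetaPertH ∧ nine spine estimates (0/9 proved); BetaPertH ⇐ (D1) ∧ (D4) ∧ CAP+tail;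
G-an2-4 gates asym, D1 and NE2/3/4.»  ABSOLUTE RULE (cell, verbatim): «No internally-minted statement may enter as a cited fact. Every
hypothesis is either kernel-proved in this package or a verbatim quotation of a PUBLISHED theorem with page reference.»
Unit `b2b-balaban-beta-an2` gen 25 (row-D1 owner), 2026-08-21.
-/

namespace Summit.QuantumFields.BalabanUV.Beta.SymGaugeMultiplierBlockMean

noncomputable section

open Finset
open scoped BigOperators Nat
open Literature.Probability.LatticeModels (TorusSite Torus.proj Torus.proj_apply)
open Literature.MathematicalPhysics.QuantumFieldTheory
open Literature.MathematicalPhysics.QuantumFieldTheory.Balaban1983to89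
open Literature.MathematicalPhysics.QuantumFieldTheory.Balaban1983to89.Beta
open AffineAveraging (Form0 Form1 Form2 Site box toSite unitVec unitVec_apply dz codiff₁ blockSum)
open AffineReproduction (IsBlockConst dz_sub)
open AveragingContours (blk grad grad_eq_dz blk_block off off_mem_box blk_add_off)
open AveragingContoursRooted (ctr ctrOff ctrOff_mem_box)
open KKTFluctuationKernel (delta1 delta1_apply)
open ResolventComposition (δSum McolSum)
open Summit.QuantumFields.BalabanUV.Beta.AxialDressingRooted (cube mem_cube bondInd bondInd_apply)
open Summit.QuantumFields.BalabanUV.Beta.AxialProjectorBlockMean (blockMeanAt grad_sub)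
open Summit.QuantumFields.BalabanUV.Beta.BorderedHessian (blockMeanAt_sub blockMeanAt_blockConst' ind sum_delta1_sub_eq_dz_ind blockMeanAt_ind
  bondInd_cast_eq_delta1' McolSum_eq_zero_of_isBlockConst)
open Summit.QuantumFields.BalabanUV.Beta.SymmetrisedAxialPotential
open Summit.QuantumFields.BalabanUV.Beta.SymmetrisedAxialGauge
open Summit.QuantumFields.BalabanUV.Beta.SymmetrisedAxialGaugeBlockMean
open Summit.QuantumFields.BalabanUV.Beta.SymmetrisedDressingMatrix
open Summit.QuantumFields.BalabanUV.Beta.SymSliceProjectorFixed (symAxProjBmAt_add symAxProjBmAt_zero)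

variable {d : ℕ}

/-! ## §1 `Π^{sym}_bm` on exact forms -/

/-- [folklore] The symmetrised gauge parameter of an exact form: `g^{sym}_{dz f}(x) = f x − f (root of the block of x)` (the `(d+1)!` cancels). -/
theorem symGaugeAt_dz (ρ : Site (d + 1)) (f : Form0 (d + 1) ℝ) (N : ℕ) :
    symGaugeAt ρ (dz f) N = f - fun x => f ((N : ℤ) • blk N x + ρ) := by
  funext x
  have hfac : ((d + 1) ! : ℝ) ≠ 0 := by exact_mod_cast (Nat.factorial_pos (d + 1)).ne'
  simp only [symGaugeAt, Pi.sub_apply]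
  rw [← grad_eq_dz, symTreeGaugeAt_grad]
  field_simp

/-- [folklore] **`Π^{sym}_bm` ON EXACT FORMS**: `Π^{sym}_bm (dz f) = dz (blockMeanAt N f)` (any root, `N ≥ 1`; cf. `axProjBmAt_dz`). -/
theorem symAxProjBmAt_dz (ρ : Site (d + 1)) {N : ℕ} (hN : 1 ≤ N) (f : Form0 (d + 1) ℝ) :
    symAxProjBmAt ρ N (dz f) = dz (blockMeanAt N f) := by
  have htg := symGaugeAt_dz ρ f N
  have hbm : blockMeanAt N (symGaugeAt ρ (dz f) N) = blockMeanAt N f - fun x => f ((N : ℤ) • blk N x + ρ) := by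
    rw [htg, blockMeanAt_sub]
    congr 1
    funext x
    exact blockMeanAt_blockConst' hN (fun y => f ((N : ℤ) • y + ρ)) x
  unfold symAxProjBmAt symBmGaugeAt
  rw [hbm, htg, show (f - fun x => f ((N : ℤ) • blk N x + ρ)) - (blockMeanAt N f - fun x => f ((N : ℤ) • blk N x + ρ)) =
    f - blockMeanAt N f by abel, grad_eq_dz, dz_sub]
  abel

/-! ## §2 The rows of `Π^{sym}_bm` as forces -/

/-- [our object] THE ROW `(β, w)` OF `Π^{sym}_bm` as a fine 1-form in the column index: `rowSym ρ N β w l y := pmSymBm ρ N β w l y`. -/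
def rowSym (ρ : Site (d + 1)) (N : ℕ) (β : Fin (d + 1)) (w : Fin (d + 1) → ℤ) : Form1 (d + 1) ℝ := fun l y => pmSymBm ρ N β w l y

/-- [folklore] Entries of `rowSym`. -/
@[simp] theorem rowSym_apply (ρ : Site (d + 1)) (N : ℕ) (β : Fin (d + 1)) (w : Fin (d + 1) → ℤ) (l : Fin (d + 1)) (y : Fin (d + 1) → ℤ) :
    rowSym ρ N β w l y = pmSymBm ρ N β w l y := rfl

/-- [folklore] The real bond indicator is the cell's `delta1`. -/
theorem bondIndR_eq_delta1 (α : Fin (d + 1)) (q : Fin (d + 1) → ℤ) : bondIndR α q = delta1 α q := bondInd_cast_eq_delta1' α q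

/-- [folklore] `rowSym` through `Π^{sym}_bm`: `rowSym ρ N β w l y = (Π^{sym}_bm δ_{(l,y)})_β(w)`. -/
theorem rowSym_eq_symAxProjBmAt (ρ : Site (d + 1)) (N : ℕ) (β : Fin (d + 1)) (w : Fin (d + 1) → ℤ) (l : Fin (d + 1)) (y : Fin (d + 1) → ℤ) :
    rowSym ρ N β w l y = symAxProjBmAt ρ N (delta1 l y) β w := by
  rw [rowSym_apply, pmSymBm, bondIndR_eq_delta1]

/-- [our object] `A ↦ (Π^{sym}_bm A)_β(w)` as an additive map. -/
def symAxProjBmAtHom (ρ : Site (d + 1)) (N : ℕ) (β : Fin (d + 1)) (w : Fin (d + 1) → ℤ) : Form1 (d + 1) ℝ →+ ℝ where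
  toFun A := symAxProjBmAt ρ N A β w
  map_zero' := by rw [symAxProjBmAt_zero]; rfl
  map_add' A B := by rw [symAxProjBmAt_add]; rfl

/-- [folklore] `symAxProjBmAtHom` evaluates `Π^{sym}_bm`. -/
theorem symAxProjBmAtHom_apply (ρ : Site (d + 1)) (N : ℕ) (β : Fin (d + 1)) (w : Fin (d + 1) → ℤ) (A : Form1 (d + 1) ℝ) :
    symAxProjBmAtHom ρ N β w A = symAxProjBmAt ρ N A β w := rfl

/-- [folklore] **THE CODIFFERENTIAL OF A ROW OF `Π^{sym}_bm`**: `codiff₁ (rowSym ρ N β w) u = (dz (blockMeanAt N 𝟙_u))_β(w)` (`N ≥ 1`). -/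
theorem codiff₁_rowSym (ρ : Site (d + 1)) {N : ℕ} (hN : 1 ≤ N) (β : Fin (d + 1)) (w u : Fin (d + 1) → ℤ) :
    codiff₁ (rowSym ρ N β w) u = dz (blockMeanAt N (ind u)) β w := by
  simp only [codiff₁, rowSym_eq_symAxProjBmAt]
  have h : ∑ l : Fin (d + 1), (symAxProjBmAt ρ N (delta1 l (u - unitVec l)) β w - symAxProjBmAt ρ N (delta1 l u) β w)
      = symAxProjBmAtHom ρ N β w (∑ l : Fin (d + 1), (delta1 l (u - unitVec l) - delta1 l u)) := by
    rw [map_sum]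
    refine Finset.sum_congr rfl fun l _ => ?_
    rw [map_sub, symAxProjBmAtHom_apply, symAxProjBmAtHom_apply]
  rw [h, sum_delta1_sub_eq_dz_ind, symAxProjBmAtHom_apply, symAxProjBmAt_dz ρ hN]

/-- [folklore] **THE CODIFFERENTIAL OF EVERY ROW OF `Π^{sym}_bm` IS BLOCK-CONSTANT.** -/
theorem isBlockConst_codiff₁_rowSym (ρ : Site (d + 1)) {N : ℕ} (hN : 1 ≤ N) (β : Fin (d + 1)) (w : Fin (d + 1) → ℤ) :
    IsBlockConst N (codiff₁ (rowSym ρ N β w)) := by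
  intro y b hb
  rw [codiff₁_rowSym ρ hN, codiff₁_rowSym ρ hN]
  simp only [dz, blockMeanAt_ind hN, blk_block y hb]
  have h0 : blk N ((N : ℤ) • y) = y := by
    have := blk_block (L := N) y (b := fun _ => 0) (Fintype.mem_piFinset.2 fun _ => Finset.mem_range.2 (by omega))
    simpa [toSite] using this
  rw [h0]

/-- [folklore] **THE GAUGE MULTIPLIER OF THE COVARIANCE FIELD DRIVEN BY A ROW OF `Π^{sym}_bm` VANISHES**: for every finite `S` carrying the row's
support (`δSum S a = rowSym`, weights `a (l, y) := pmSymBm ρ N β w l y`), `McolSum S a = 0` (engine `McolSum_eq_zero_of_isBlockConst` BY NAME). -/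
theorem McolSum_rowSym_eq_zero {N : ℕ} [NeZero N] (ρ : Site (d + 1)) (β : Fin (d + 1)) (w : Fin (d + 1) → ℤ)
    (S : Finset (Fin (d + 1) × AffineAveraging.Site (d + 1))) (hS : δSum S (fun b => pmSymBm ρ N β w b.1 b.2) = rowSym ρ N β w) :
    McolSum (N := N) S (fun b => pmSymBm ρ N β w b.1 b.2) = 0 :=
  McolSum_eq_zero_of_isBlockConst S _ (by rw [hS]; exact isBlockConst_codiff₁_rowSym ρ (Nat.one_le_iff_ne_zero.mpr (NeZero.ne N)) β w)

end

end Summit.QuantumFields.BalabanUV.Beta.SymGaugeMultiplierBlockMean
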